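import Summits.QuantumFields.YangMills.Theorems.BalabanUVNodesN19KeyedCoreEdgeHolderD4LettersK3V5
import Summits.QuantumFields.YangMills.Theorems.BalabanUVNodesN19RateEdgeHolderD4AtTrimmedLedgerReading

/-!
# BalabanUVNodes ∕ N19 — K3⁷ v5 BY NAME AT THE TRIMMED LEDGER READING: stub 2's N19′ conjunct `K3V5Defs.KeyedCoreEdgeHolderD4 β cr (K3V5Defs.rrOfRecord 𝔯 ksel)` from
# `K3V5Defs.GuardedReadingN16` ALONE, `2∕3 < β ≤ 1` (stub 2's own binder range), K1⁷'s window, def-W1's letter rows `hs hL h9` + the ∀μν windowed (5.10) letter `hWall`, and the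
# TRIMMED ledger link reading `hlinkTrim` (this seat g4: the g3 ledger reading MINUS its five idle letters `θc θ₃ γ₃ l₁ dressed`); the plug; the crux's statement CONDITIONALLY —
# the N19′-side bill of K3⁷ at v5's key with NODE O's displayed obligation at its smallest equivalent form

Cell `pub-ymgap`, HUMAN RULING D-0062 (Track A), WIDTH SEAT `pub-ymgap-dag-n19-w3` (N19 NE7, seat 3 of 3), generation g4; bus INTENT-3.  Cluster item K3⁷ «SpineGivenEndpointR13SepCoPH»
(stmt-QuantumFields-20544), plan's skeleton **v5 941dddb108cbaacf** (UNTOUCHED); dag-n27-w1's BY-NAME MIRROR `…K3V5Defs` (p606160).  Filed `--kind proof --supports` that item `--as helper`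
(proves no registered stub).  COUNT-NEUTRAL.  THEOREMS ONLY; 0 `def`; 0 `sorry`; `N = 2`, the item guard, reading-generic `cr`.  Imports this seat's g3 `…LettersK3V5` (p618248: by name at
the ledger reading, `hunif` ∕ `hdecT` discharged via dag-n19-w5 p615362 ∕ p616024) and g4 `…AtTrimmedLedgerReading` (p620894: trimmed ⇒ ledger reading) — CITED BY NAME, none edited; the
(B)-free theorem re-walks g3's chain `…AtLedgerReading` → `…AtKeyedReading` → `…AtPinnedReading` → `…AtN16PinnedReadingFSC` (p613740 ∕ p611389 ∕ p609283 ∕ p607220) by name.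

WHAT THIS FILE PROVES (section hypotheses: `hG16`, `hβ1`, `hβw`, `hlinkTrim`; theorem binders: `hβ23 : 2∕3 < β` and the letter rows `hs hL h9 hWall` — ALL HYPOTHESES).  Three
one-application theorems over the g3 sibling's, with `hlinkLedger := linkReadingAtLedgerReading_of_linkReadingAtTrimmedLedgerReading cr 𝔯 G hlinkTrim hβ23 hG16.2.1 hG16.2.2.1` (the
loose pin and THE END's rows read from v5's key; `G` = the item guard):
* ★★★ `keyedCoreEdgeHolderD4BFree_rrOfRecord_of_guardedReadingN16_letters_trimmedLinkReading` — the (B)-FREE, END-FREE shape of the conjunct (plan g85's rev-28 ∕ K3 «v6» text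
  `KeyedCoreEdgeHolderD4BFree β cr (rrOfRecord 𝔯 ksel)` SPELLED; transfers to every version slot by the sheet's `keyedCoreEdgeHolderD4V_of_bFree`) — kernel evidence that (B) ∕ END are
  read nowhere on this lineage's road;
* ★★★ `keyedCoreEdgeHolderD4_rrOfRecord_of_guardedReadingN16_letters_trimmedLinkReading : … → KeyedCoreEdgeHolderD4 β cr (rrOfRecord 𝔯 ksel)`;
* ★★ `hybridNE7Under_of_guardedReadingN16_keyedFaces_letters_trimmedLinkReading` (+ stub 1's rates conjunct + stub 2's N20 ∕ N21 ∕ N27x faces);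
* ★★ `spineGivenEndpointR13SepCoPH_of_guardedReadingN16_keyedFaces_letters_trimmedLinkReading` — THE N19′-SIDE BILL OF K3⁷ AT v5's KEY, TRIMMED: v5's key `GuardedReadingN16`,
  `2∕3 < β ≤ 1`, K1⁷'s rung-2 window (`hβw`), def-W1's letter rows `hs hL h9` + `hWall`, NODE O's ledger world `hlinkTrim` (0∕1 inhabited: run pins · `EB` recovery + selector · (i)
  `LedgerAtSync` at the rate floors `(R.u3.ρ, θ^(3β−2))` · ledger letters · (ii-m) · N11's family rows · (v′-16) N07∕N16∕readings rows), stub 1's rates conjunct, stub 2's three other faces.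
  CONDITIONAL; NOT a proof of K3⁷.
A6 NOTE (dag-n21-w6 `…N21N16bSqueezeAtN19Rows`, p614571, READ): the (v′-16) radii rows KEPT in `hlinkTrim` (`R.ne3.b ≤ t`, `c' ≤ t`, `2^76·L^12·t ≤ R.ne3.ε`,
`4·((ℓ₃ F).ε ∕ B F) ≤ c'`) force the squeeze `2^76·L^12·b ≤ ε` and the floor `2^78·L^12 ≤ B F` on v5's N16 letters and are UNSATISFIABLE at THE END's letter recipe of record
(`not_squeeze_of_endRecipe`); v5's key does not carry them (`exists_lettersEnd_radiusMatch_not_squeeze`) — a non-vacuous instance of this bill needs them displayed key-side or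
producer-side (plan's (t-N16b) word).  The trim neither adds nor removes any of those rows.

HONEST FRAMING.  Count-neutral kernel bookkeeping; every antecedent is a HYPOTHESIS; the last theorem is a CONDITIONAL reading of the crux's statement, NOT a proof of it — K3⁷
stmt-QuantumFields-20544 stays OPEN and UNCLAIMED, no stub is proved, the skeleton v5 is untouched; nothing of Bałaban's asserted or instantiated (K0⁷ OPEN); NE7 ∕ NE9 ∕ (5.10)-at-the-record
NOT PRINTED as two-run statements ∕ NOT proved; N14 ∕ N16 ∕ N19 ∕ N22 NOT discharged; counts unmoved (typed 28∕28 · discharged 5∕27 · A 5∕28).  One finite four-torus at fixed ε — R4 closes the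
CONDITIONAL finite-𝕋⁴ rung `BalabanLadder.UV` only; NOT infinite volume ∕ OS ∕ mass gap; the YM mass gap (Clay) is NOT proved by any of this.  Standard axioms.  Edits nothing.
-/

set_option autoImplicit false

noncomputable section

open Finset MeasureTheory
open scoped BigOperators Matrix Matrix.Norms.L2Operator

namespace Summit.QuantumFields.YangMills.BalabanUVNodes.N19KeyedCoreEdgeHolderD4TrimmedK3V5

open Literature.MathematicalPhysics.QuantumFieldTheory.Balaban1983to89
open T4OutputRate T4RecentScale T4GoodClassBudget T4CauchySum T4TowerRateComposition T4TowerRateDischarge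
open T4EtaRateMin (Readings NE3Shape)
open T4RateLiaison (GaugeDominated)
open FlowStep (RGEqH prefixOf)
open TreeLengthTorus (TFaceConnected torusTreeLen)
open B12TreeDecay (kappa₀)
open Summit.QuantumFields.BalabanUV.T4Continuum
open AveragingDeficitDualResidual (dualC1 dualC2)
open AveragingDeficitDerivWallProof (wallConst)
open AveragingDeficitPeriodicCounting (IsPeriodicDir)
open MinimalActionSandwich (IsMinimiser minAct)
open MinimalActionRate (sfClass)
open MinimalActionRefine (RegularSup gradConst)
open NE3EnergyShapes (IsUnitarySite IsPeriodicSite)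
open NE3.LeafIndexSockets (LeafH3sup)
open Summit.QuantumFields.BalabanUV.T4Continuum.Spine
open Summit.QuantumFields.BalabanUV.T4Continuum.Spine.NE4 (runFlow)
open Summit.QuantumFields.BalabanUV.T4Continuum.NE1p.DressedRoot (DressedTower DressedStabilityStrict)
open Summit.QuantumFields.YangMills.BalabanUVNodes.N19LedgerLinkSync (LedgerDataSync LedgerAtSync)
open YMDAG.UVSplit (SpineCarriers SpineRecordPred InputsPred U3Carriers RateCarriers RateRecordPred N14At N18At N22At ReadOutAt)
open Summit.QuantumFields.YangMills.BalabanUVNodes.N16HolderDefs (CovRootHolder N16HolderAt)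
open Summit.QuantumFields.YangMills.BalabanUVNodes.SpineRatesHolder (RatesHolderAt)
open Literature.MathematicalPhysics.QuantumFieldTheory.Balaban1983to89.T4Continuum (T4Family ULoop)
open YMDAG.UVSplit (Datum RateReading₁₃CoPH rateCarriersOfRecord₁₃CoPH ne3OfRecord₁₁)
open Node00 (Stage13HParams datumOfRecord₁₃CoPH SiteSeqKey NE3Letters₁₁ ne3ConstLayerOfRecord₁₁ ne3NperOfRecord₁₁ ne3DomOfRecord₁₁)
open Summit.QuantumFields.YangMills.BalabanUVNodes.N16PinnedLayer13CoPH (N16PinnedLoose N16LettersEnd)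
open YMDAG.N14.TopBorn (ne1OfRecord obsSupNorm)
open Node00 (U3Letters₁₁)
open Literature.MathematicalPhysics.QuantumFieldTheory.Balaban1983to89.Node00.U3OfKernels (objectsOfRecord₁₃)
open T4WeightBudget (RelWeightBound)
open T4IndicatorShell (ShellWeightBound)
open T4ContinuumYM4Torus (ForSmallCouplings)
open T4ApexHybrid (HybridNE7Under)
open Summit.QuantumFields.YangMills.Theorems.K3V5Defs (SpineReading RunSel LetterReading rrOfRecord PHolderD4 KeyedRatesHolderD4 GuardedReadingN16 KeyedRelWeight KeyedShellWeight
  KeyedCoreEdgeHolderD4 KeyedExtraction)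
open Literature.MathematicalPhysics.QuantumFieldTheory.Balaban1983to89.Node00.U3KernelLetters (PolLimitsExistOfRecord₁₃ WindowedNE9OfRecord₁₃ WindowedDecayOfRecord₁₃)
open Summit.QuantumFields.YangMills.BalabanUVNodes.N19KeyedCoreEdgeHolderD4LettersK3V5 (keyedCoreEdgeHolderD4_rrOfRecord_of_guardedReadingN16_letters_ledgerLinkReading
  hybridNE7Under_of_guardedReadingN16_keyedFaces_letters_ledgerLinkReading)
open Summit.QuantumFields.YangMills.BalabanUVNodes.N19RateEdgeHolderD4AtTrimmedLedgerReading (linkReadingAtLedgerReading_of_linkReadingAtTrimmedLedgerReading)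
open Summit.QuantumFields.YangMills.BalabanUVNodes.N19UniformLettersAtU3Pin (hunif_of_u3Pinned_of_signs)
open Summit.QuantumFields.YangMills.BalabanUVNodes.N19BundleDecayLetterFromStub1Rows (hdecT_of_u3Pinned_of_stub1Rows)
open Summit.QuantumFields.YangMills.BalabanUVNodes.N19RateEdgeHolderD4AtN16PinnedReadingFSC (forSmallCouplings_h19HolderD4_datumOfRecord₁₃CoPH_of_linkReadingAtN16PinnedReading)
open Summit.QuantumFields.YangMills.BalabanUVNodes.N19RateEdgeHolderD4AtPinnedReading (linkReadingAtN16PinnedReading_of_linkReadingAtPinnedReading)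
open Summit.QuantumFields.YangMills.BalabanUVNodes.N19RateEdgeHolderD4AtKeyedReading (linkReadingAtPinnedReading_of_linkReadingAtKeyedReading)
open Summit.QuantumFields.YangMills.BalabanUVNodes.N19RateEdgeHolderD4AtLedgerReading (linkReadingAtKeyedReading_of_linkReadingAtLedgerReading)

section ByName

variable (cr : SpineReading) (𝔯 : RateReading₁₃CoPH 2) (ksel : RunSel) (ℓ : LetterReading) (ℓ₃ : T4Family → NE3Letters₁₁) (g B : T4Family → ℝ) {β : ℝ} (hβ1 : β ≤ 1)
  (hG16 : GuardedReadingN16 𝔯 ksel ℓ ℓ₃ g B)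
    (hβw : ∀ (F : T4Family) (θ : Stage13HParams F 2) (hP : θ.Provisos₁₃CoPH F 2), (θ.ZhUnity F 2 ∧ θ.SlotsNondegenerate₁₃ F 2) → θ.Admissible F 2 →
      ∃ γ₀ b b' : ℝ, 0 < γ₀ ∧ 0 < b ∧ DagBinding.BetaBoundsInInterval (datumOfRecord₁₃CoPH F 2 θ hP).C.toB12 γ₀ b b')
  (hlinkTrim : ∀ (F : T4Family) (θ : Stage13HParams F 2) (hP : θ.Provisos₁₃CoPH F 2), (θ.ZhUnity F 2 ∧ θ.SlotsNondegenerate₁₃ F 2) → θ.Admissible F 2 →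
    ∀ (γ gIR b : ℝ) (g₀ : ℕ → ℝ), (datumOfRecord₁₃CoPH F 2 θ hP).Tuned γ gIR g₀ → γ ≤ θ.γ → γ ^ 2 ≤ Real.exp (-1) → 0 < b →
    (∀ K m, 0 ≤ m → m < K → b ≤ (datumOfRecord₁₃CoPH F 2 θ hP).βfun m (prefixOf (runFlow (datumOfRecord₁₃CoPH F 2 θ hP) g₀ K) m)) →
    ∀ (os : List (ULoop F)) (k : ℕ),
      let S : SpineCarriers := cr F θ hP g₀ os
      let R : RateCarriers 2 := rateCarriersOfRecord₁₃CoPH 𝔯 F θ hP g₀ os k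
      let D : Datum F 2 := datumOfRecord₁₃CoPH F 2 θ hP
      letI := S.dec
      ∃ (_ : DecidableEq R.u3.C.Dom) (F' : Type) (ι' X' : Type) (_ : MeasurableSpace ι')
        (L : LedgerDataSync R.u3.C F' ι' S.ι) (Rd : Readings ι' X') (bsel : (ℕ → ℝ) → ℝ) (EB : Functional R.u3.C R.u3.C.BgB)
        (g : ℕ → ℕ → ℝ)
        (uA : ℕ → ι' → R.u3.C.BgA) (uB : ℕ → ι' → R.u3.C.BgB)
        (Pf : ℕ → Params) (d₀ L₀ Koff : ℕ) (cells : (K j : ℕ) → R.u3.C.Dom → Finset (Site (Pf K) j))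
        (H033 : Flow → ℕ → Prop) (I : Type) (fam : I → B14.Sect2Data) (Lb βw : ℝ) (κ₁ : ℕ) (Gv Cl : ℝ) (K₁ : ℕ)
        (c' t θ : ℝ)
        (sel : ℕ → (B7Prop1Explicit.Site 4 → Fin 4 → (Matrix (Fin 2) (Fin 2) ℂ)ˣ) → (B7Prop1Explicit.Site 4 → Fin 4 → (Matrix (Fin 2) (Fin 2) ℂ)ˣ))
        (rd : ι' → (B7Prop1Explicit.Site 4 → Fin 4 → (Matrix (Fin 2) (Fin 2) ℂ)ˣ)),
        (∀ K i, i ≤ K → g K i = runFlow D g₀ K i) ∧ (∀ K i, K < i → g K i = gIR) ∧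
        EB = (fun s => R.u3.EB (bsel s) s) ∧
        (∀ (Sz : ℕ → ℝ → S.ι → ℕ → ℝ) (E₀ : ℝ) (m : ℕ) (a : ℝ) (Cw Λg : ℝ),
          (∀ K t, |t| ≤ S.l₀ → ∀ τ ∈ S.T K \ S.Bad K t, ∀ v ∈ Rd.dom, ∀ j ≤ K,
            |∑ X ∈ L.fac K t τ with R.u3.C.scale X = j,
                (Real.log (Real.exp (EB (fun i => g (K + 1) (i + 1)) (uB K v) X
                    - EB (fun i => g (K + 1) (i + 1)) L.oneB X))
                  - Real.log (Real.exp (R.u3.EA (g K) (uA K v) X - R.u3.EA (g K) L.oneA X)))| ≤ Sz K t τ j) →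
          0 ≤ E₀ → 0 < a → a < 1 →
          (∀ K t, |t| ≤ S.l₀ → ∀ τ ∈ S.T K \ S.Bad K t, ∀ j ≤ K,
            Sz K t τ j ≤ S.vol * (E₀ * ((K : ℝ) + 1) ^ m * a ^ (K - j))) →
          (∀ K, Multiplicity (L.All K) R.u3.C.scale (fun X => Real.exp (-(R.u3.κ * R.u3.C.d X))) Cw S.vol Λg K) →
          (∀ K t, |t| ≤ S.l₀ → ∀ τ ∈ S.T K \ S.Bad K t,
            WindowMultiplicity (L.facO K t τ) L.scO L.wO Cw S.vol Λg (jlogOf L.Cl K) K) →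
          1 ≤ Λg → L.θ' ≤ Λg →
          LedgerAtSync { L with S := Sz, E₀ := E₀, m := m, a := a, Cw := Cw, Λg := Λg } S.l₀ S.vol S.T S.Bad
            (fun K t τ => S.A K t τ - S.shA K t τ) (fun K t τ => S.B K t τ - S.shB K t τ) Rd R.u3.EA EB R.u3.κ g uA uB
            R.u3.ω R.u3.ρ R.u3.θ (θ ^ ((3 : ℝ) * β - 2))) ∧
        0 ≤ S.vol ∧
        (∀ K t, |t| ≤ S.l₀ → ∀ τ ∈ S.T K \ S.Bad K t,
          WindowMultiplicity (L.facO K t τ) L.scO L.wO L.Cw S.vol L.Λg (jlogOf L.Cl K) K) ∧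
        0 ≤ L.Cw ∧ 1 ≤ L.Λg ∧ L.θ' ≤ L.Λg ∧
        (∀ K, (Pf K).d = d₀) ∧ (∀ K, (Pf K).L = L₀) ∧ (∀ K, (Pf K).K = Koff + K) ∧
        (∀ K, (Fintype.card (Site (Pf K) (Pf K).K) : ℝ) = S.vol) ∧
        kappa₀ (4 * 2 ^ d₀) (2 * d₀) ≤ R.u3.κ ∧
        (∀ K, ∀ X ∈ L.All K,
          (cells K (R.u3.C.scale X + Koff) X).Nonempty ∧ TFaceConnected (cells K (R.u3.C.scale X + Koff) X)) ∧
        (∀ K j, Set.InjOn (cells K j) ↑((L.All K).filter fun X => R.u3.C.scale X + Koff = j)) ∧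
        (∀ K, ∀ X ∈ L.All K, torusTreeLen (cells K (R.u3.C.scale X + Koff) X) ≤ R.u3.C.d X) ∧
        B14.Thm2Printed H033 fam Lb βw κ₁ ∧ βw < 1 ∧ 0 < βw ∧ 1 < Lb ∧ 1 ≤ Gv ∧ 0 ≤ Cl ∧
        (∀ K t, |t| ≤ S.l₀ → ∀ τ ∈ S.T K \ S.Bad K t, ∀ j ≤ K, ∃ (i : I) (w : (fam i).Ω) (j' : ℕ),
          (fam i).flow.SatisfiesRG (fam i).K ∧ H033 (fam i).flow (fam i).K ∧ 1 ≤ j' ∧ j' ≤ (fam i).K ∧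
          (fam i).K - j' = K - j ∧ (fam i).K ≤ K + K₁ ∧
          (∀ n, 0 ≤ (fam i).gammaVol n w) ∧ (fam i).gammaVol (fam i).K w ≤ S.vol ∧
          (∀ n, n < (fam i).K → n < jlogOf Cl (fam i).K → (fam i).gammaVol n w = 0) ∧
          (∀ n, n < (fam i).K → jlogOf Cl (fam i).K ≤ n → (fam i).gammaVol n w ≤ S.vol * Gv ^ ((fam i).K - n))) ∧
        R.ne3.g = gradConst 4 c' ∧ 0 ≤ c' ∧ R.ne3.b ≤ t ∧ c' ≤ t ∧
        (2 : ℝ) ^ 91 * (R.ne3.L : ℝ) ^ 17 * t ≤ 1 ∧ (2 : ℝ) ^ 76 * (R.ne3.L : ℝ) ^ 12 * t ≤ R.ne3.ε ∧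
        16 * B7Prop2Explicit.C0 4 * R.ne3.ε ≤ 3 ∧ 1024 * (4 + 1) * (4 + 4) * (R.ne3.L : ℝ) ^ 2 * R.ne3.ε ≤ 1 ∧
        4 * ((ℓ₃ F).ε / B F) ≤ c' ∧
        LeafH3sup 4 R.ne3.L R.ne3.Nper R.ne3.ε R.ne3.b c' R.ne3.dom ∧
        (∀ V ∈ R.ne3.dom, ∀ k : ℕ, IsMinimiser 4 (sfClass 4 R.ne3.L R.ne3.Nper R.ne3.ε) R.ne3.L R.ne3.Nper k V (sel k V)) ∧
        (∀ V ∈ R.ne3.dom, ∀ k : ℕ, RegularSup 4 R.ne3.L R.ne3.Nper R.ne3.b c' k (sel k V)) ∧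
        0 < θ ∧ θ ^ 6 = ((R.ne3.L : ℝ))⁻¹ ∧
        (∀ v ∈ Rd.dom, rd v ∈ R.ne3.dom) ∧
        (∀ k, ∀ v ∈ Rd.dom, Rd.act k v = minAct 4 (sfClass 4 R.ne3.L R.ne3.Nper R.ne3.ε) R.ne3.L R.ne3.Nper k (rd v)) ∧
        (R.ne3.Nper : ℝ) ^ 4 ≤ Rd.vol ∧
        (∀ s ∈ Window γ, 0 < bsel s ∧ bsel s ≤ γ))

include hβ1 hG16 hβw hlinkTrim

/-- ★★★ **THE (B)-FREE, END-FREE SHAPE OF STUB 2's N19′ CONJUNCT AT THE TRIMMED LEDGER READING** [bookkeeping] — plan g85's K3 «v6» ∕ rev-28 text `KeyedCoreEdgeHolderD4BFree β cr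
(rrOfRecord 𝔯 ksel)` SPELLED (YMPLAN-G85-SHAPE-SHEET-REV28: v5's `KeyedCoreEdgeHolderD4` with its two UNREAD prefix binders `B16.EndStatementBPrinted …` ∕ `EndpointExistence …`
dropped): from v5's key, `2∕3 < β ≤ 1`, K1⁷'s window `hβw`, stub 1's letter rows `hs hL h9` + `hWall` and NODE O's trimmed ledger reading.  Kernel evidence for this lineage's census
answer «no» — (B) and END are read NOWHERE on the road: the chain is g3's (8b) composition VERBATIM (trimmed → ledger → keyed → pinned → N16-pinned reading, then the g3 FSC supplier
`forSmallCouplings_h19HolderD4_…AtN16PinnedReading` and `.mono` at the selected run length), `hunif`∕`hdecT` from dag-n19-w5 p615362∕p616024.  By the sheet's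
`keyedCoreEdgeHolderD4V_of_bFree` ∕ `keyedCoreEdgeHolderD4_of_bFree` this text transfers to EVERY version slot `v` and gives v5's own conjunct (next theorem).  NOT the stub, NOT K3⁷ ∕ K3⁸;
N14 ∕ N16 ∕ N19 ∕ N22 NOT discharged. -/
theorem keyedCoreEdgeHolderD4BFree_rrOfRecord_of_guardedReadingN16_letters_trimmedLinkReading (hβ23 : 2 / 3 < β)
    (hs : ∀ (F : T4Family) (θ : Stage13HParams F 2), θ.Provisos₁₃CoPH F 2 → (θ.ZhUnity F 2 ∧ θ.SlotsNondegenerate₁₃ F 2) → θ.Admissible F 2 → (ℓ F θ).Signs)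
    (hL : ∀ (F : T4Family) (θ : Stage13HParams F 2), θ.Provisos₁₃CoPH F 2 → (θ.ZhUnity F 2 ∧ θ.SlotsNondegenerate₁₃ F 2) → θ.Admissible F 2 →
      PolLimitsExistOfRecord₁₃ F 2 θ.toStage13Params)
    (h9 : ∀ (F : T4Family) (θ : Stage13HParams F 2), θ.Provisos₁₃CoPH F 2 → (θ.ZhUnity F 2 ∧ θ.SlotsNondegenerate₁₃ F 2) → θ.Admissible F 2 →
      WindowedNE9OfRecord₁₃ F 2 θ.toStage13Params (ℓ F θ).κ (ℓ F θ).moduli)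
    (hWall : ∀ (μ ν : Fin 4) (F : T4Family) (θ : Stage13HParams F 2), θ.Provisos₁₃CoPH F 2 → (θ.ZhUnity F 2 ∧ θ.SlotsNondegenerate₁₃ F 2) → θ.Admissible F 2 →
      WindowedDecayOfRecord₁₃ F 2 θ.toStage13Params μ ν (ℓ F θ).κ) :
    ∀ (F : T4Family) (θ : Stage13HParams F 2) (hP : θ.Provisos₁₃CoPH F 2), (θ.ZhUnity F 2 ∧ θ.SlotsNondegenerate₁₃ F 2) → θ.Admissible F 2 →
      ForSmallCouplings (datumOfRecord₁₃CoPH F 2 θ hP) fun g₀ => ∀ os : List (ULoop F),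
        PHolderD4 β (datumOfRecord₁₃CoPH F 2 θ hP) (rrOfRecord 𝔯 ksel F θ hP g₀ os) → letI := (cr F θ hP g₀ os).dec
          ∃ δ : ℕ → ℝ, NE7.Core (cr F θ hP g₀ os).l₀ (cr F θ hP g₀ os).vol (cr F θ hP g₀ os).T (cr F θ hP g₀ os).Bad
            (fun K t τ => (cr F θ hP g₀ os).A K t τ - (cr F θ hP g₀ os).shA K t τ) (fun K t τ => (cr F θ hP g₀ os).B K t τ - (cr F θ hP g₀ os).shB K t τ) δ ∧
            Summable δ := by
  obtain ⟨⟨hpin1ex, -, -, hpinU3⟩, hpinL, hend, hmatch⟩ := hG16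
  obtain ⟨l₀, Λ, hl₀, hΛ, hpin1⟩ := hpin1ex
  intro F θ hP hGd hθ
  obtain ⟨γ₀, b, b', hγ₀, hb0, hβ⟩ := hβw F θ hP hGd hθ
  obtain ⟨M, ρ₁, hM, hρ₁, hu⟩ := hunif_of_u3Pinned_of_signs 𝔯 (fun θ => θ.ZhUnity _ 2 ∧ θ.SlotsNondegenerate₁₃ _ 2) ℓ hpinU3 hs F θ hP hGd hθ
  exact (forSmallCouplings_h19HolderD4_datumOfRecord₁₃CoPH_of_linkReadingAtN16PinnedReading cr 𝔯 (fun θ => θ.ZhUnity _ 2 ∧ θ.SlotsNondegenerate₁₃ _ 2) hβ1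
      (linkReadingAtN16PinnedReading_of_linkReadingAtPinnedReading cr 𝔯 (fun θ => θ.ZhUnity _ 2 ∧ θ.SlotsNondegenerate₁₃ _ 2)
        (linkReadingAtPinnedReading_of_linkReadingAtKeyedReading cr 𝔯 (fun θ => θ.ZhUnity _ 2 ∧ θ.SlotsNondegenerate₁₃ _ 2)
          (linkReadingAtKeyedReading_of_linkReadingAtLedgerReading cr 𝔯 (fun θ => θ.ZhUnity _ 2 ∧ θ.SlotsNondegenerate₁₃ _ 2)
            (linkReadingAtLedgerReading_of_linkReadingAtTrimmedLedgerReading cr 𝔯 (fun θ => θ.ZhUnity _ 2 ∧ θ.SlotsNondegenerate₁₃ _ 2) hlinkTrim hβ23 hpinL hend)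
            (hdecT_of_u3Pinned_of_stub1Rows 𝔯 (fun θ => θ.ZhUnity _ 2 ∧ θ.SlotsNondegenerate₁₃ _ 2) ℓ hpinU3 hs hL h9 hWall))
          hl₀.le ℓ hpinU3) hl₀.le hΛ hpin1)
      hpinL hmatch hend F θ hP hGd hθ hγ₀ hb0 hβ hM hρ₁ hu).mono fun g₀ h os => h os (ksel F θ hP g₀ os)

/-- ★★★ **STUB 2's N19′ CONJUNCT BY NAME, KEYED ON v5's KEY + STUB 1's LETTER ROWS + THE ∀μν WINDOWED (5.10) LETTER + K1⁷'s WINDOW + NODE O's TRIMMED LEDGER READING** [bookkeeping]: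
the g3 sibling's ★★★ (`…LettersK3V5`) with `hlinkLedger := linkReadingAtLedgerReading_of_linkReadingAtTrimmedLedgerReading … hlinkTrim hβ23 hG16.2.1 hG16.2.2.1` (the loose N16 pin and
THE END's rows read from `hG16`).  ONE FACE of `stub_expansion13H` modulo displayed hypotheses — NOT the stub, NOT K3⁷; N14 ∕ N16 ∕ N19 ∕ N22 NOT discharged. -/
theorem keyedCoreEdgeHolderD4_rrOfRecord_of_guardedReadingN16_letters_trimmedLinkReading (hβ23 : 2 / 3 < β)
    (hs : ∀ (F : T4Family) (θ : Stage13HParams F 2), θ.Provisos₁₃CoPH F 2 → (θ.ZhUnity F 2 ∧ θ.SlotsNondegenerate₁₃ F 2) → θ.Admissible F 2 → (ℓ F θ).Signs)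
    (hL : ∀ (F : T4Family) (θ : Stage13HParams F 2), θ.Provisos₁₃CoPH F 2 → (θ.ZhUnity F 2 ∧ θ.SlotsNondegenerate₁₃ F 2) → θ.Admissible F 2 →
      PolLimitsExistOfRecord₁₃ F 2 θ.toStage13Params)
    (h9 : ∀ (F : T4Family) (θ : Stage13HParams F 2), θ.Provisos₁₃CoPH F 2 → (θ.ZhUnity F 2 ∧ θ.SlotsNondegenerate₁₃ F 2) → θ.Admissible F 2 →
      WindowedNE9OfRecord₁₃ F 2 θ.toStage13Params (ℓ F θ).κ (ℓ F θ).moduli)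
    (hWall : ∀ (μ ν : Fin 4) (F : T4Family) (θ : Stage13HParams F 2), θ.Provisos₁₃CoPH F 2 → (θ.ZhUnity F 2 ∧ θ.SlotsNondegenerate₁₃ F 2) → θ.Admissible F 2 →
      WindowedDecayOfRecord₁₃ F 2 θ.toStage13Params μ ν (ℓ F θ).κ) :
    KeyedCoreEdgeHolderD4 β cr (rrOfRecord 𝔯 ksel) :=
  keyedCoreEdgeHolderD4_rrOfRecord_of_guardedReadingN16_letters_ledgerLinkReading cr 𝔯 ksel ℓ ℓ₃ g B hβ1 hG16 hβw
    (linkReadingAtLedgerReading_of_linkReadingAtTrimmedLedgerReading cr 𝔯 (fun θ => θ.ZhUnity _ 2 ∧ θ.SlotsNondegenerate₁₃ _ 2) hlinkTrim hβ23 hG16.2.1 hG16.2.2.1)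
    hs hL h9 hWall

/-- ★★ **`HybridNE7Under` PER GUARDED ADMISSIBLE TUPLE, SAME KEY + STUB 1's RATES CONJUNCT + STUB 2's OTHER FACES, AT THE TRIMMED LEDGER READING** [bookkeeping]: the g3 sibling's plug
with `hlinkLedger` supplied from `hlinkTrim`.  Hypotheses displayed; NOT K3⁷; no stub proved; N19 NOT discharged. -/
theorem hybridNE7Under_of_guardedReadingN16_keyedFaces_letters_trimmedLinkReading (hβ23 : 2 / 3 < β)
    (hs : ∀ (F : T4Family) (θ : Stage13HParams F 2), θ.Provisos₁₃CoPH F 2 → (θ.ZhUnity F 2 ∧ θ.SlotsNondegenerate₁₃ F 2) → θ.Admissible F 2 → (ℓ F θ).Signs)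
    (hL : ∀ (F : T4Family) (θ : Stage13HParams F 2), θ.Provisos₁₃CoPH F 2 → (θ.ZhUnity F 2 ∧ θ.SlotsNondegenerate₁₃ F 2) → θ.Admissible F 2 →
      PolLimitsExistOfRecord₁₃ F 2 θ.toStage13Params)
    (h9 : ∀ (F : T4Family) (θ : Stage13HParams F 2), θ.Provisos₁₃CoPH F 2 → (θ.ZhUnity F 2 ∧ θ.SlotsNondegenerate₁₃ F 2) → θ.Admissible F 2 →
      WindowedNE9OfRecord₁₃ F 2 θ.toStage13Params (ℓ F θ).κ (ℓ F θ).moduli)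
    (hWall : ∀ (μ ν : Fin 4) (F : T4Family) (θ : Stage13HParams F 2), θ.Provisos₁₃CoPH F 2 → (θ.ZhUnity F 2 ∧ θ.SlotsNondegenerate₁₃ F 2) → θ.Admissible F 2 →
      WindowedDecayOfRecord₁₃ F 2 θ.toStage13Params μ ν (ℓ F θ).κ)
    (hr : KeyedRatesHolderD4 β (rrOfRecord 𝔯 ksel)) (h20 : KeyedRelWeight cr) (h21 : KeyedShellWeight cr) (hx : KeyedExtraction cr)
    (F : T4Family) (θ : Stage13HParams F 2) (hP : θ.Provisos₁₃CoPH F 2) (hGd : θ.ZhUnity F 2 ∧ θ.SlotsNondegenerate₁₃ F 2) (hθ : θ.Admissible F 2) :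
    HybridNE7Under (datumOfRecord₁₃CoPH F 2 θ hP) (DagBinding.EndpointExistence (datumOfRecord₁₃CoPH F 2 θ hP).C.toB12) :=
  hybridNE7Under_of_guardedReadingN16_keyedFaces_letters_ledgerLinkReading cr 𝔯 ksel ℓ ℓ₃ g B hβ1 hG16 hβw
    (linkReadingAtLedgerReading_of_linkReadingAtTrimmedLedgerReading cr 𝔯 (fun θ => θ.ZhUnity _ 2 ∧ θ.SlotsNondegenerate₁₃ _ 2) hlinkTrim hβ23 hG16.2.1 hG16.2.2.1)
    hs hL h9 hWall hr h20 h21 hx F θ hP hGd hθ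

/-- ★★ **K3⁷'s STATEMENT BY NAME, CONDITIONALLY — THE N19′-SIDE BILL AT v5's KEY IN STUB 1's VOCABULARY, WITH NODE O's OBLIGATION TRIMMED** [bookkeeping]:
`…Theses.BalabanUVNodes.SpineGivenEndpointR13SepCoPH` from the displayed HYPOTHESES: v5's key `GuardedReadingN16`, `2∕3 < β ≤ 1`, K1⁷'s window `hβw`, def-W1's letter rows `hs hL h9` +
the ∀μν windowed (5.10) letter `hWall`, NODE O's TRIMMED ledger reading `hlinkTrim` (the g3 ledger reading minus its five idle letters; equivalent to it by the siblings
`…AtTrimmedLedgerReading` ∕ `…Iff`), stub 1's `KeyedRatesHolderD4 β (rrOfRecord 𝔯 ksel)`, stub 2's `KeyedRelWeight cr` ∕ `KeyedShellWeight cr` ∕ `KeyedExtraction cr` — the previous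
theorem at `hP.toCore`.  A CONDITIONAL reading of the crux; NOT a proof of K3⁷ (OPEN, unclaimed); no stub proved; nothing of Bałaban asserted; N19 NOT discharged; counts unmoved. -/
theorem spineGivenEndpointR13SepCoPH_of_guardedReadingN16_keyedFaces_letters_trimmedLinkReading (hβ23 : 2 / 3 < β)
    (hs : ∀ (F : T4Family) (θ : Stage13HParams F 2), θ.Provisos₁₃CoPH F 2 → (θ.ZhUnity F 2 ∧ θ.SlotsNondegenerate₁₃ F 2) → θ.Admissible F 2 → (ℓ F θ).Signs)
    (hL : ∀ (F : T4Family) (θ : Stage13HParams F 2), θ.Provisos₁₃CoPH F 2 → (θ.ZhUnity F 2 ∧ θ.SlotsNondegenerate₁₃ F 2) → θ.Admissible F 2 →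
      PolLimitsExistOfRecord₁₃ F 2 θ.toStage13Params)
    (h9 : ∀ (F : T4Family) (θ : Stage13HParams F 2), θ.Provisos₁₃CoPH F 2 → (θ.ZhUnity F 2 ∧ θ.SlotsNondegenerate₁₃ F 2) → θ.Admissible F 2 →
      WindowedNE9OfRecord₁₃ F 2 θ.toStage13Params (ℓ F θ).κ (ℓ F θ).moduli)
    (hWall : ∀ (μ ν : Fin 4) (F : T4Family) (θ : Stage13HParams F 2), θ.Provisos₁₃CoPH F 2 → (θ.ZhUnity F 2 ∧ θ.SlotsNondegenerate₁₃ F 2) → θ.Admissible F 2 →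
      WindowedDecayOfRecord₁₃ F 2 θ.toStage13Params μ ν (ℓ F θ).κ)
    (hr : KeyedRatesHolderD4 β (rrOfRecord 𝔯 ksel)) (h20 : KeyedRelWeight cr) (h21 : KeyedShellWeight cr) (hx : KeyedExtraction cr) :
    Summit.QuantumFields.YangMills.Theses.BalabanUVNodes.SpineGivenEndpointR13SepCoPH :=
  fun F θ hP hGd hθ _ _ =>
    hybridNE7Under_of_guardedReadingN16_keyedFaces_letters_trimmedLinkReading cr 𝔯 ksel ℓ ℓ₃ g B hβ1 hG16 hβw hlinkTrim hβ23 hs hL h9 hWall hr h20 h21 hx F θ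
      hP.toCore hGd hθ

end ByName

end Summit.QuantumFields.YangMills.BalabanUVNodes.N19KeyedCoreEdgeHolderD4TrimmedK3V5
end
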